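import Summits.HodgeConjecture.CorCM.MultiFieldWeilSeparatedThreefoldBlocks
import HarnessLib

/-!
# MULTI-FIELD WEIL ENGINE — SEPARATED BLOCKS: (stable) nondegeneracy is decided block by block

Cell `pub-hodgecm2` (COR-CM), seat b30 gen 35 (2026-08-25); count-neutral own lane MULTI-FIELD WEIL ENGINE (stem `MultiFieldWeil*`), a corollary file of
`CorCM/MultiFieldWeilSeparatedThreefoldBlocks.lean`.  Theorems only; no definition, no named fact, no `sorry`.  HONEST FRAMING: UNCONDITIONAL structure theorems on
Mumford–Tate groups of CM abelian varieties; `HC_CM` is NOT touched.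

THE STATEMENT (**`isNondegenerateFamily_iff_separatedBlocks`**).  `A_i ⊨ (K_i; Φ_i)` (`i ∈ I` finite) SIMPLE of dimension `≤ 3`; `b : I → C` a labelling separating
differently labelled sextic slots (different Galois closures, no common imaginary quadratic subfield); `κ : I ↠ D`, `val : D ↪ Option C` reading the blocks (`some (b t)` for the
slots through the sextic field `K_t`, `none` for the slots through no sextic member field).  Then the family `(Φ_i)_i` is nondegenerate — `dim Hg(∏_i A_i) = Σ_i dim A_i`, i.e.
every Hodge class on every product of copies is a polynomial in divisor classes — IF AND ONLY IF every block sub-family is.  With the labels read off canonically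
(**`isNondegenerateFamily_iff_separatedLabels`**): iff, for every label `c`, the threefolds of label `c` with the curves through their fields form a nondegenerate family, AND
the surfaces with the remaining curves do.  (p2's `CMAlgebra.isNondegenerateFamily_iff_forall_fiber_of_pairwise_slots` under the cross-block slot criterion of the previous
file.)  Inside the blocks seat b16's censuses decide: two threefolds through one imaginary quadratic field are degenerate, a dihedral surface triple is degenerate, etc.

[cite: MoonenZarhin1999LowDim, Thm. (0.2), §3 (3.1), Cor. (3.9)] [cite: Gordon1999HodgeAVSurvey, §3 Theorem (proof), 7.4–7.7] [cite: Shimura1998, §8.2 Prop. 26, §8.4 (2)]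

## References
* [MoonenZarhin1999LowDim] B. Moonen, Yu. Zarhin, Math. Ann. 315 (1999) 711–733.  [Gordon1999HodgeAVSurvey] B. B. Gordon, *A survey of the Hodge conjecture for abelian
  varieties*, §3, 7.4–7.7.  [Shimura1998] G. Shimura, *Abelian varieties with complex multiplication and modular functions*, §8.2, §8.4.
-/

noncomputable section

open CategoryTheory CategoryTheory.Limits NumberField IntermediateField

namespace Summit.HodgeConjecture.CorCM.MultiFieldWeil

open Literature.AlgebraicGeometry Literature.AlgebraicGeometry.Motives Literature.AlgebraicGeometry.HodgeTheory
open Literature.AlgebraicGeometry.ComplexMultiplication (IsCMTypeRealisation)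
open Literature.AlgebraicTopology.SingularHomology
open Literature.NumberTheory.ComplexMultiplication
open Literature.AlgebraicGeometry.Pohlmann1968

open scoped Classical

section Rank

variable {I : Type} [Fintype I] {K : I → Type} [∀ i, Field (K i)] [∀ i, NumberField (K i)] [∀ i, IsCMField (K i)]
  {Φ : ∀ i, CMType (K i)} {A : I → AbelianVariety ℂ} {ι : ∀ i, 𝓞 (K i) →+* End (A i)} {θ : ∀ i, K i →+* Module.End ℂ (complexBetti (A i).X 1)}
  {C : Type}

/-- **NONDEGENERACY IS DECIDED ON THE SEPARATED BLOCKS.**  Same setting as `cmFamilyRank_add_card_eq_separatedBlocks`: the whole family is nondegenerate iff every block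
sub-family is. [cite: MoonenZarhin1999LowDim, §3 (3.1)] [cite: Gordon1999HodgeAVSurvey, 7.5] -/
theorem isNondegenerateFamily_iff_separatedBlocks [Nonempty I] (hA : ∀ i, IsCMTypeRealisation (Φ i) (A i) (ι i) (θ i)) (hS : ∀ i, (A i).IsSimple)
    (h3 : ∀ i, (A i).dim ≤ 3) (b : I → C)
    (hsep : ∀ t t', Module.finrank ℚ (K t) = 6 → Module.finrank ℚ (K t') = 6 → b t ≠ b t' →
      normalClosure ℚ (K t) ℂ ≠ normalClosure ℚ (K t') ℂ ∧ ¬ ∃ F : IntermediateField ℚ (K t), Module.finrank ℚ F = 2 ∧ IsTotallyComplex F ∧ Nonempty (F →+* K t'))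
    {D : Type} [Fintype D] (κ : I → D) (hκ : Function.Surjective κ) (val : D → Option C) (hval : Function.Injective val)
    (hsome : ∀ i t, Module.finrank ℚ (K t) = 6 → Nonempty (K i →+* K t) → val (κ i) = some (b t))
    (hnone : ∀ i, (¬ ∃ t, Module.finrank ℚ (K t) = 6 ∧ Nonempty (K i →+* K t)) → val (κ i) = none) :
    CMAlgebra.IsNondegenerateFamily Φ ↔ ∀ d, CMAlgebra.IsNondegenerateFamily fun i : {i : I // κ i = d} => Φ i.1 := by
  refine CMAlgebra.isNondegenerateFamily_iff_forall_fiber_of_pairwise_slots Φ κ hκ fun i j hij => ?_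
  have hv : val (κ i) ≠ val (κ j) := fun h => hij (hval h)
  by_cases hi : ∃ t, Module.finrank ℚ (K t) = 6 ∧ Nonempty (K i →+* K t) <;> by_cases hj : ∃ t, Module.finrank ℚ (K t) = 6 ∧ Nonempty (K j →+* K t)
  · obtain ⟨t, ht, ⟨e⟩⟩ := hi
    obtain ⟨t', ht', ⟨e'⟩⟩ := hj
    have hb : b t ≠ b t' := fun h => hv (by rw [hsome i t ht ⟨e⟩, hsome j t' ht' ⟨e'⟩, h])
    exact (pairwise_separatedBlocks hA hS h3 b hsep ht ht' e e' hb).1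
  · exact (pairwise_threefoldBlock_surfaceBlock hA hS h3 hi hj).1
  · exact (pairwise_threefoldBlock_surfaceBlock hA hS h3 hj hi).2
  · exact absurd ((hnone i hi).trans (hnone j hj).symm) hv

/-- **With the labels read off canonically**: the family is nondegenerate iff (a) for every label `c` met, the sub-family of the slots through a sextic member field of label
`c` (the threefolds labelled `c` and the curves through their fields) is nondegenerate, and (b) the sub-family of the slots through no sextic member field (the surfaces and
the other curves) is nondegenerate — provided both kinds of slots occur (else there is nothing to split). [cite: MoonenZarhin1999LowDim, §3 (3.1)] [cite: Gordon1999HodgeAVSurvey, 7.5] -/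
theorem isNondegenerateFamily_iff_separatedLabels [Nonempty I] (hA : ∀ i, IsCMTypeRealisation (Φ i) (A i) (ι i) (θ i)) (hS : ∀ i, (A i).IsSimple)
    (h3 : ∀ i, (A i).dim ≤ 3) (b : I → C)
    (hsep : ∀ t t', Module.finrank ℚ (K t) = 6 → Module.finrank ℚ (K t') = 6 → b t ≠ b t' →
      normalClosure ℚ (K t) ℂ ≠ normalClosure ℚ (K t') ℂ ∧ ¬ ∃ F : IntermediateField ℚ (K t), Module.finrank ℚ F = 2 ∧ IsTotallyComplex F ∧ Nonempty (F →+* K t')) :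
    CMAlgebra.IsNondegenerateFamily Φ ↔
      (∀ c : C, (∃ i t, Module.finrank ℚ (K t) = 6 ∧ Nonempty (K i →+* K t) ∧ b t = c) →
          CMAlgebra.IsNondegenerateFamily fun i : {i : I // ∃ t, Module.finrank ℚ (K t) = 6 ∧ Nonempty (K i →+* K t) ∧ b t = c} => Φ i.1) ∧
        ((∃ j, ¬ ∃ t, Module.finrank ℚ (K t) = 6 ∧ Nonempty (K j →+* K t)) →
          CMAlgebra.IsNondegenerateFamily fun i : {i : I // ¬ ∃ t, Module.finrank ℚ (K t) = 6 ∧ Nonempty (K i →+* K t)} => Φ i.1) := by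
  -- the block of a slot, read off the labels
  let blk : I → Option C := fun i => if h : ∃ t, Module.finrank ℚ (K t) = 6 ∧ Nonempty (K i →+* K t) then some (b (Classical.choose h)) else none
  have hblk_some : ∀ i t, Module.finrank ℚ (K t) = 6 → Nonempty (K i →+* K t) → blk i = some (b t) := by
    intro i t ht hne
    have h : ∃ t, Module.finrank ℚ (K t) = 6 ∧ Nonempty (K i →+* K t) := ⟨t, ht, hne⟩
    have hc := Classical.choose_spec h
    obtain ⟨e₀⟩ := hc.2
    obtain ⟨e⟩ := hne
    simp only [blk, dif_pos h, Option.some.injEq]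
    exact label_eq_of_ringHom_ringHom hA h3 b hsep hc.1 ht e₀ e
  have hblk_none : ∀ i, (¬ ∃ t, Module.finrank ℚ (K t) = 6 ∧ Nonempty (K i →+* K t)) → blk i = none := fun i h => by
    simp only [blk, dif_neg h]
  -- membership in the blocks, as predicates
  have hmem_some : ∀ i c, blk i = some c ↔ ∃ t, Module.finrank ℚ (K t) = 6 ∧ Nonempty (K i →+* K t) ∧ b t = c := by
    intro i c
    constructor
    · intro h1
      by_cases h : ∃ t, Module.finrank ℚ (K t) = 6 ∧ Nonempty (K i →+* K t)
      · obtain ⟨t, ht, hne⟩ := h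
        refine ⟨t, ht, hne, ?_⟩
        rw [hblk_some i t ht hne, Option.some.injEq] at h1
        exact h1
      · rw [hblk_none i h] at h1
        exact absurd h1 (Option.some_ne_none c).symm
    · rintro ⟨t, ht, hne, rfl⟩
      exact hblk_some i t ht hne
  have hmem_none : ∀ i, blk i = none ↔ ¬ ∃ t, Module.finrank ℚ (K t) = 6 ∧ Nonempty (K i →+* K t) := by
    intro i
    constructor
    · intro h1 ⟨t, ht, hne⟩
      rw [hblk_some i t ht hne] at h1
      exact Option.some_ne_none _ h1
    · exact hblk_none i
  -- the blocks met, as a finite type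
  let D : Type := {o : Option C // ∃ i, blk i = o}
  let κ : I → D := fun i => ⟨blk i, i, rfl⟩
  have hκ : Function.Surjective κ := by
    rintro ⟨o, i, hi⟩
    exact ⟨i, Subtype.ext hi⟩
  haveI : Fintype D := Fintype.ofSurjective κ hκ
  have key := isNondegenerateFamily_iff_separatedBlocks hA hS h3 b hsep κ hκ (fun d => d.1) Subtype.val_injective (fun i t ht hne => hblk_some i t ht hne)
    (fun i hi => hblk_none i hi)
  -- re-indexing a block sub-family along pointwise-equivalent predicates preserves nondegeneracy (whatever the `Fintype` instances)
  have hreidx : ∀ (p q : I → Prop) (fp : Fintype {i : I // p i}) (fq : Fintype {i : I // q i}), (∀ i, p i ↔ q i) →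
      (@CMAlgebra.IsNondegenerateFamily {i : I // p i} (fun i => K i.1) (fun i => inferInstance) (fun i => inferInstance) fp (fun i => Φ i.1) ↔
        @CMAlgebra.IsNondegenerateFamily {i : I // q i} (fun i => K i.1) (fun i => inferInstance) (fun i => inferInstance) fq (fun i => Φ i.1)) := by
    intro p q fp fq hpq
    have hpq' : p = q := funext fun i => propext (hpq i)
    subst hpq'
    rw [Subsingleton.elim fp fq]
  have hκ_some : ∀ (c : C) (hd : ∃ i, blk i = some c) (i : I),
      κ i = (⟨some c, hd⟩ : D) ↔ ∃ t, Module.finrank ℚ (K t) = 6 ∧ Nonempty (K i →+* K t) ∧ b t = c := fun c hd i =>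
    (Subtype.ext_iff.trans (by exact Iff.rfl)).trans (hmem_some i c)
  have hκ_none : ∀ (hd : ∃ i, blk i = none) (i : I),
      κ i = (⟨none, hd⟩ : D) ↔ ¬ ∃ t, Module.finrank ℚ (K t) = 6 ∧ Nonempty (K i →+* K t) := fun hd i =>
    (Subtype.ext_iff.trans (by exact Iff.rfl)).trans (hmem_none i)
  rw [key]
  constructor
  · intro h
    refine ⟨fun c hc => ?_, fun hj => ?_⟩
    · obtain ⟨i, t, ht, hne, hbt⟩ := hc
      have hd : ∃ i', blk i' = some c := ⟨i, (hmem_some i c).2 ⟨t, ht, hne, hbt⟩⟩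
      exact (hreidx _ _ _ _ (hκ_some c hd)).1 (h ⟨some c, hd⟩)
    · obtain ⟨j, hj⟩ := hj
      have hd : ∃ i', blk i' = none := ⟨j, hblk_none j hj⟩
      exact (hreidx _ _ _ _ (hκ_none hd)).1 (h ⟨none, hd⟩)
  · rintro ⟨hT, hN⟩ ⟨_ | c, hd⟩
    · obtain ⟨i, hi⟩ := id hd
      exact (hreidx _ _ _ _ (hκ_none hd)).2 (hN ⟨i, (hmem_none i).1 hi⟩)
    · obtain ⟨i, hi⟩ := id hd
      exact (hreidx _ _ _ _ (hκ_some c hd)).2 (hT c ⟨i, (hmem_some i c).1 hi⟩)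

end Rank

end Summit.HodgeConjecture.CorCM.MultiFieldWeil

end
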